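import Literature.Analysis.FluidPDE.TaoWhitneyKernel
import Literature.Analysis.FluidPDE.TaoY6RadialChange
import HarnessLib

/-!
# Tao (2011/2013), proof of Thm. 10.1, the term `Y₆`: geometry of the radial chains in the annulus

Analysis/FluidPDE support file for the discharge of the nonlinear estimate `Y₆` of Tao 2011, §10
(arXiv:1108.1165, proof of Thm. 10.1, p. 33: "for any small ball `Bᵢ`, we may assign a 'parent'
ball `B_{p(i)}` which touches the ball but has radius at least `1.001` (say) as large as that of
`Bᵢ`. We may iterate this until we reach a large ball `B_{a(i)}`"), in the annular geometry of
Remark 10.6 and for the continuous Whitney family of `TaoWhitneyKernel` (depth `d = annDepth`,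
radius `ρ = whitneyRadius = min(d, k⁻¹)/100` on `Ω = {a < |y - x₀| < b}`). The parent of the
Whitney ball about a point `y` of the **inner layer** (`t = |y - x₀| - a` small) is the Whitney
ball about the radially displaced point `T y = radialStep x₀ a λ y` (`TaoY6RadialChange`),
`λ = 103/100`; symmetrically on the **outer layer** (`t' = b - |y - x₀|` small) with
`T' = radialStep x₀ b λ`. This file records the elementary geometry:

* on the inner half `{a < |y-x₀|, |y-x₀| - a ≤ (b-a)/2}` the depth is `d(y) = |y - x₀| - a`, and
  `ρ(y) = (|y-x₀| - a)/100` as long as moreover `|y - x₀| - a ≤ k⁻¹`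
  (`annDepth_eq_inner`, `whitneyRadius_eq_inner`); symmetrically on the outer half;
* the step maps multiply the inner/outer depth by `μ` (`inner_depth_radialStep`,
  `outer_depth_radialStep`), displace by `(μ - 1)` times the depth, compose along rays
  (`radialStep_radialStep`), and for `μ = λ = 103/100` in the linear regime:
  `ρ(T y) = λ ρ(y)`, `|T y - y| = 3ρ(y)`, and `B(T y, 3ρ(T y)) ⊆ B(y, 10ρ(y))`
  (`ball_radialStep_subset`), the container of the Poincaré comparison (10.22).

## References

* T. Tao, arXiv:1108.1165 (`Tao2011`), §10, proof of Thm. 10.1 (p. 33) and Remark 10.6.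
-/

noncomputable section

open MeasureTheory Set Function Filter Metric Topology
open scoped ENNReal NNReal

namespace Literature.Analysis.FluidPDE

/-- Local notation for physical space `ℝ³ = EuclideanSpace ℝ (Fin 3)`. -/
local notation "ℝ³" => EuclideanSpace ℝ (Fin 3)

section Geometry

variable {x₀ : ℝ³} {a b k : ℝ}

/-! ### Depth and radius on the two halves of the annulus -/

/-- On the inner half of the annulus the depth is the distance to the inner sphere:
`d(y) = |y - x₀| - a` when `|y - x₀| - a ≤ (b - a)/2`. [folklore] -/
theorem annDepth_eq_inner {y : ℝ³} (h : ‖y - x₀‖ - a ≤ (b - a) / 2) :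
    annDepth x₀ a b y = ‖y - x₀‖ - a := by
  rw [annDepth_def, min_eq_left]
  linarith

/-- On the outer half of the annulus the depth is the distance to the outer sphere:
`d(y) = b - |y - x₀|` when `b - |y - x₀| ≤ (b - a)/2`. [folklore] -/
theorem annDepth_eq_outer {y : ℝ³} (h : b - ‖y - x₀‖ ≤ (b - a) / 2) :
    annDepth x₀ a b y = b - ‖y - x₀‖ := by
  rw [annDepth_def, min_eq_right]
  linarith

/-- The Whitney radius in the linear regime: `ρ(y) = d(y)/100` when `0 ≤ d(y) ≤ k⁻¹`. [folklore] -/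
theorem whitneyRadius_eq_of_le {y : ℝ³} (h0 : 0 ≤ annDepth x₀ a b y) (h1 : annDepth x₀ a b y ≤ k⁻¹) :
    whitneyRadius x₀ a b k y = annDepth x₀ a b y / 100 := by
  rw [whitneyRadius_def, min_eq_left h1, max_eq_right h0]

/-- The Whitney radius on the inner layer: `ρ(y) = (|y - x₀| - a)/100` when
`0 ≤ |y - x₀| - a ≤ min((b-a)/2, k⁻¹)`. [folklore] -/
theorem whitneyRadius_eq_inner {y : ℝ³} (h0 : 0 ≤ ‖y - x₀‖ - a) (h1 : ‖y - x₀‖ - a ≤ (b - a) / 2)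
    (h2 : ‖y - x₀‖ - a ≤ k⁻¹) : whitneyRadius x₀ a b k y = (‖y - x₀‖ - a) / 100 := by
  have hd := annDepth_eq_inner (x₀ := x₀) (a := a) (b := b) h1
  rw [whitneyRadius_eq_of_le (by rw [hd]; exact h0) (by rw [hd]; exact h2), hd]

/-- The Whitney radius on the outer layer: `ρ(y) = (b - |y - x₀|)/100` when
`0 ≤ b - |y - x₀| ≤ min((b-a)/2, k⁻¹)`. [folklore] -/
theorem whitneyRadius_eq_outer {y : ℝ³} (h0 : 0 ≤ b - ‖y - x₀‖) (h1 : b - ‖y - x₀‖ ≤ (b - a) / 2)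
    (h2 : b - ‖y - x₀‖ ≤ k⁻¹) : whitneyRadius x₀ a b k y = (b - ‖y - x₀‖) / 100 := by
  have hd := annDepth_eq_outer (x₀ := x₀) (a := a) (b := b) h1
  rw [whitneyRadius_eq_of_le (by rw [hd]; exact h0) (by rw [hd]; exact h2), hd]

/-! ### The step maps on the two layers -/

/-- **The inner step map multiplies the inner depth**: for `a ≥ 0`, `μ ≥ 0` and `|y - x₀| > a`,
`|T y - x₀| - a = μ (|y - x₀| - a)`, `T = radialStep x₀ a μ`. [folklore] -/
theorem inner_depth_radialStep (ha : 0 ≤ a) {μ : ℝ} (hμ : 0 ≤ μ) {y : ℝ³} (hy : a < ‖y - x₀‖) :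
    ‖radialStep x₀ a μ y - x₀‖ - a = μ * (‖y - x₀‖ - a) := by
  have hy0 : y ≠ x₀ := by
    intro h; rw [h, sub_self, norm_zero] at hy; linarith
  rw [norm_radialStep_sub hy0, abs_of_nonneg (by nlinarith)]
  ring

/-- **The outer step map multiplies the outer depth**: for `y ≠ x₀` and `μ (b - |y - x₀|) ≤ b`, `b - |T' y - x₀| = μ (b - |y - x₀|)`, `T' = radialStep x₀ b μ`. [folklore] -/
theorem outer_depth_radialStep {μ : ℝ} {y : ℝ³} (hy0 : y ≠ x₀) (hμb : μ * (b - ‖y - x₀‖) ≤ b) :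
    b - ‖radialStep x₀ b μ y - x₀‖ = μ * (b - ‖y - x₀‖) := by
  rw [norm_radialStep_sub hy0, abs_of_nonneg (by nlinarith)]
  ring

/-- The inner step map keeps points on the inner side: `a ≤ |T y - x₀|`. [folklore] -/
theorem le_norm_radialStep_inner (ha : 0 ≤ a) {μ : ℝ} (hμ : 0 ≤ μ) {y : ℝ³} (hy : a < ‖y - x₀‖) :
    a ≤ ‖radialStep x₀ a μ y - x₀‖ := by
  have h := inner_depth_radialStep (x₀ := x₀) ha hμ hy
  nlinarith

/-- The outer step map keeps points on the outer side: `|T' y - x₀| ≤ b`. [folklore] -/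
theorem norm_radialStep_outer_le {μ : ℝ} (hμ : 0 ≤ μ) {y : ℝ³} (hy0 : y ≠ x₀) (hy : ‖y - x₀‖ ≤ b)
    (hμb : μ * (b - ‖y - x₀‖) ≤ b) : ‖radialStep x₀ b μ y - x₀‖ ≤ b := by
  have h := outer_depth_radialStep (x₀ := x₀) hy0 hμb
  nlinarith

/-- **Composition along rays**: `T_μ (T_ν y) = T_{μν} y` for the step maps with a common pivot
`p`, whenever `y ≠ x₀` and `T_ν y` stays off the centre on the positive side
(`0 < p + ν(|y - x₀| - p)`). [folklore] -/
theorem radialStep_radialStep {p μ ν : ℝ} {y : ℝ³} (hy : y ≠ x₀) (hpos : 0 < p + ν * (‖y - x₀‖ - p)) :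
    radialStep x₀ p μ (radialStep x₀ p ν y) = radialStep x₀ p (μ * ν) y := by
  have hr : 0 < ‖y - x₀‖ := norm_pos_iff.2 (sub_ne_zero.2 hy)
  set r := ‖y - x₀‖ with hrdef
  set u : ℝ³ := r⁻¹ • (y - x₀) with hu
  have hun : ‖u‖ = 1 := by
    rw [hu, norm_smul, norm_inv, Real.norm_of_nonneg hr.le, ← hrdef, inv_mul_cancel₀ hr.ne']
  have hy' : y = x₀ + r • u := by
    rw [hu, smul_smul, mul_inv_cancel₀ hr.ne', one_smul, add_sub_cancel]
  have h1 : radialStep x₀ p ν y = x₀ + (p + ν * (r - p)) • u := by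
    conv_lhs => rw [hy']
    exact radialStep_ray hr hun
  have h2 : radialStep x₀ p (μ * ν) y = x₀ + (p + μ * ν * (r - p)) • u := by
    conv_lhs => rw [hy']
    exact radialStep_ray hr hun
  rw [h1, h2, radialStep_ray hpos hun]
  congr 1
  ring_nf

/-! ### The parent move with `λ = 103/100` on the inner layer -/

/-- The chain factor `λ = 103/100` (Tao's "radius at least `1.001` as large"; here `1.03`, so that
the displacement is exactly `3ρ`). [cite: Tao2011, §10, proof of Thm. 10.1 (p. 33, parent balls)] -/
def chainFactor : ℝ := 103 / 100

/-- `λ = 103/100`. [folklore] -/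
theorem chainFactor_eq : chainFactor = 103 / 100 := rfl

/-- `1 ≤ λ`. [folklore] -/
theorem one_le_chainFactor : 1 ≤ chainFactor := by rw [chainFactor_eq]; norm_num

/-- `1 < λ`. [folklore] -/
theorem one_lt_chainFactor : 1 < chainFactor := by rw [chainFactor_eq]; norm_num

/-- `0 < λ`. [folklore] -/
theorem chainFactor_pos : 0 < chainFactor := by rw [chainFactor_eq]; norm_num

/-- **The inner parent point**: for `y` on the inner layer with `0 < t = |y - x₀| - a`,
`λᵐ⁺¹ t ≤ min((b-a)/2, k⁻¹)` (linear regime before and after the move), the point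
`z = radialStep x₀ a λ (radialStep x₀ a λᵐ y) = radialStep x₀ a λᵐ⁺¹ y` satisfies
`ρ(z) = λ ρ(y')` and `|z - y'| = 3ρ(y')` where `y' = radialStep x₀ a λᵐ y`; stated for a single
move from a point `y'` of inner depth `t'`: `ρ(T y') = λρ(y')`, `|T y' - y'| = 3ρ(y')`. [cite: Tao2011, §10, proof of Thm. 10.1 (p. 33)] -/
theorem inner_parent (ha : 0 ≤ a) {y : ℝ³} (hy : a < ‖y - x₀‖)
    (h1 : chainFactor * (‖y - x₀‖ - a) ≤ (b - a) / 2) (h2 : chainFactor * (‖y - x₀‖ - a) ≤ k⁻¹) :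
    whitneyRadius x₀ a b k (radialStep x₀ a chainFactor y) = chainFactor * whitneyRadius x₀ a b k y ∧
      ‖radialStep x₀ a chainFactor y - y‖ = 3 * whitneyRadius x₀ a b k y := by
  have hlam := one_le_chainFactor
  have ht0 : 0 < ‖y - x₀‖ - a := by linarith
  have h1' : ‖y - x₀‖ - a ≤ (b - a) / 2 := le_trans (le_mul_of_one_le_left ht0.le hlam) h1
  have h2' : ‖y - x₀‖ - a ≤ k⁻¹ := le_trans (le_mul_of_one_le_left ht0.le hlam) h2
  have hρy : whitneyRadius x₀ a b k y = (‖y - x₀‖ - a) / 100 := whitneyRadius_eq_inner ht0.le h1' h2'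
  have hT : ‖radialStep x₀ a chainFactor y - x₀‖ - a = chainFactor * (‖y - x₀‖ - a) :=
    inner_depth_radialStep ha chainFactor_pos.le hy
  have hρT : whitneyRadius x₀ a b k (radialStep x₀ a chainFactor y) = chainFactor * (‖y - x₀‖ - a) / 100 := by
    rw [whitneyRadius_eq_inner (by rw [hT]; positivity) (by rw [hT]; exact h1) (by rw [hT]; exact h2), hT]
  have hy0 : y ≠ x₀ := by intro h; rw [h, sub_self, norm_zero] at hy; linarith
  refine ⟨by rw [hρT, hρy]; ring, ?_⟩
  rw [norm_radialStep_sub_self hy0, hρy, chainFactor_eq, abs_of_pos ht0]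
  norm_num
  ring

/-- **The outer parent point**: for `y ≠ x₀` on the outer layer with `0 < t' = b - |y - x₀|` and
`λ t' ≤ min((b-a)/2, k⁻¹)`, `λ t' ≤ b`: `ρ(T' y) = λρ(y)` and `|T' y - y| = 3ρ(y)`. [cite: Tao2011, §10, proof of Thm. 10.1 (p. 33) + Remark 10.6] -/
theorem outer_parent {y : ℝ³} (hy0 : y ≠ x₀) (hy : ‖y - x₀‖ < b)
    (h1 : chainFactor * (b - ‖y - x₀‖) ≤ (b - a) / 2) (h2 : chainFactor * (b - ‖y - x₀‖) ≤ k⁻¹)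
    (h3 : chainFactor * (b - ‖y - x₀‖) ≤ b) :
    whitneyRadius x₀ a b k (radialStep x₀ b chainFactor y) = chainFactor * whitneyRadius x₀ a b k y ∧
      ‖radialStep x₀ b chainFactor y - y‖ = 3 * whitneyRadius x₀ a b k y := by
  have hlam := one_le_chainFactor
  have ht0 : 0 < b - ‖y - x₀‖ := by linarith
  have h1' : b - ‖y - x₀‖ ≤ (b - a) / 2 := le_trans (le_mul_of_one_le_left ht0.le hlam) h1
  have h2' : b - ‖y - x₀‖ ≤ k⁻¹ := le_trans (le_mul_of_one_le_left ht0.le hlam) h2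
  have hρy : whitneyRadius x₀ a b k y = (b - ‖y - x₀‖) / 100 := whitneyRadius_eq_outer ht0.le h1' h2'
  have hT : b - ‖radialStep x₀ b chainFactor y - x₀‖ = chainFactor * (b - ‖y - x₀‖) :=
    outer_depth_radialStep hy0 h3
  have hρT : whitneyRadius x₀ a b k (radialStep x₀ b chainFactor y) = chainFactor * (b - ‖y - x₀‖) / 100 := by
    rw [whitneyRadius_eq_outer (by rw [hT]; positivity) (by rw [hT]; exact h1) (by rw [hT]; exact h2), hT]
  refine ⟨by rw [hρT, hρy]; ring, ?_⟩
  rw [norm_radialStep_sub_self hy0, hρy, chainFactor_eq, abs_of_neg (by linarith : ‖y - x₀‖ - b < 0)]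
  norm_num
  ring

/-- **The Poincaré container**: if `ρ(z) = λρ(y)` and `|z - y| = 3ρ(y)` (a parent move) then
`B(z, 3ρ(z)) ⊆ B(y, 10ρ(y))` (and trivially `B(y, 3ρ(y)) ⊆ B(y, 10ρ(y))`). [cite: Tao2011, §10, proof of Thm. 10.1 ((10.22): the ball 10Bᵢ)] -/
theorem ball_parent_subset {y z : ℝ³} {ρy ρz : ℝ} (hρ : ρz = chainFactor * ρy) (hd : ‖z - y‖ = 3 * ρy) :
    ball z (3 * ρz) ⊆ ball y (10 * ρy) := by
  intro w hw
  rw [mem_ball, dist_eq_norm] at hw ⊢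
  have hρy : 0 ≤ ρy := by have := norm_nonneg (z - y); linarith
  calc ‖w - y‖ = ‖(w - z) + (z - y)‖ := by abel_nf
    _ ≤ ‖w - z‖ + ‖z - y‖ := norm_add_le _ _
    _ < 3 * ρz + 3 * ρy := by linarith
    _ = (3 * chainFactor + 3) * ρy := by rw [hρ]; ring
    _ ≤ 10 * ρy := by rw [chainFactor_eq]; nlinarith

/-- The own ball is in the container: `B(y, 3ρ) ⊆ B(y, 10ρ)` for `ρ ≥ 0`. [folklore] -/
theorem ball_three_subset_ball_ten (y : ℝ³) {ρ : ℝ} (hρ : 0 ≤ ρ) : ball y (3 * ρ) ⊆ ball y (10 * ρ) :=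
  ball_subset_ball (by nlinarith)

end Geometry

end Literature.Analysis.FluidPDE

end
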